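import Mathlib
import HarnessLib
import Literature.AlgebraicGeometry.Resolution.AlterationsStrong
import Summits.ResolutionOfSingularities.ResolutionOfSingularities.Theorems.WildQuotientsWildQuotientResolutionS1aPrincipalCentreGood
import Summits.ResolutionOfSingularities.ResolutionOfSingularities.Theorems.WildQuotientsWildQuotientResolutionS1aKillMoveWins
import Summits.ResolutionOfSingularities.ResolutionOfSingularities.Theorems.WildQuotientsWildQuotientResolutionS1aKillMeasure
import Summits.ResolutionOfSingularities.ResolutionOfSingularities.Theorems.WildQuotientsWildQuotientResolutionS1aKillCentreRule

/-!
# S1a — THE PRINCIPAL-CENTRE RULE: the (T2-consumer)/(T5-lite) chain and the crux residual in the weakest (principal-kill) form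

[OURS · L1 W4.5c · lead-1 g7] — NOT statements of the manuscript; counted 0; AI-level work, weaker than expert review.
Crux stmt-ResolutionOfSingularities-17941, line `s1a-logminvertex` v6, stub `stub_winningStrategy`. Route-independent (no `Theses` import).
This file re-bases `…S1aKillMoveWins`, `…S1aKillMeasure`, `…S1aKillCentreRule` on `NodeAtlas.IsPrincipalCentre` (`…S1aPrincipalCentre`):
the only property of a kill-centre chart the chain ever used is that the lifted automorphism of each chart ring has principal
augmentation ideal, so the residual of the crux WEAKENS to

* **`PrincipalCentreRule p`** (OURS CANDIDATE, asserted nowhere): every non-terminal `G`-model of finite type over a Noetherian base admits a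
  PRINCIPAL centre whose principal-centre charts meet every irreducible component of the bad locus;
* `principalKillOpen`, `mem_badLocus_of_principalMove`, `wins_of_isPrincipalCentre`, `exists_isInducing_badLocus_principalMove`,
  `nu1_principalMove_lt`, `wins_of_principalCentres`, `wins_initial_of_principalCentreRule`, `principalCentreRule_of_killCentreRule`.
-/

set_option linter.dupNamespace false

noncomputable section

open CategoryTheory Limits AlgebraicGeometry TopologicalSpace Topology
open Literature.AlgebraicGeometry.Resolution Literature.AlgebraicGeometry.RelativeSpec
open Summit.ResolutionOfSingularities.ResolutionOfSingularities.Theorems.WildQuotientResolution.S1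
open Summit.ResolutionOfSingularities.ResolutionOfSingularities.Theorems.WildQuotientResolution.S1.NodeAtlas
open Summit.ResolutionOfSingularities.ResolutionOfSingularities.Theorems.WildQuotientResolution.S1.BlowupCharts
open Summit.ResolutionOfSingularities.ResolutionOfSingularities.Theorems.WildQuotientResolution.S1.GoodCharts

namespace Summit.ResolutionOfSingularities.ResolutionOfSingularities.Theorems.WildQuotientResolution.S1

/-- **THE PRINCIPAL-CENTRE RULE at the prime `p`** [OURS · L1 W4.5c — CANDIDATE, the residual of `stub_winningStrategy` in its weakest
form; NOT a statement of the manuscript, NOT asserted]: every non-terminal `G`-model (`G = ⟨g₀⟩` finite) of finite type over a Noetherian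
affine base fixed by `G` admits a PRINCIPAL centre (`NodeAtlas.IsPrincipalCentre`: K1′ σ-adapted homogeneous weighted centre charts on
every chart of whose blow-up the lifted automorphism has principal augmentation ideal) whose principal-centre charts meet every
irreducible component of the bad locus. ONE-PHASE SPECIAL CASE (plan-1 CHAIN v10.5): conjecturally FALSE in general — W3 (`p = 5`,
dim 4, `L/w45c/P3-W3.md`) has no principal centre at its initial model but dies in two moves; the general residual is the two-phase
`KillOrAuxRule` (`…S1aKillOrAux`). It does settle the uniformly-feasible class (ctrl14, i36/i6-adapted, 34/50 census-v2 specimens). -/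
def PrincipalCentreRule (p : ℕ) : Prop :=
  ∀ ⦃X' X₁ : Scheme.{0}⦄ (q : X' ⟶ X₁) (G : Type) [Group G] [Finite G] (ρ : G →* Aut X') (g₀ : G),
    (∀ g : G, g ∈ Subgroup.zpowers g₀) →
    ∀ M : GameFrame.GModel p q G ρ g₀, M.HasNoetherianBase → ¬ M.Terminal →
      ∃ (𝒦 : ReesFiltration M.V) (d : ℕ), IsPrincipalCentre p M.act g₀ 𝒦 d ∧
        ∀ t ∈ irreducibleComponents ↥M.badLocus, ∃ x ∈ t, ∃ O : M.act.StableAffineOpens,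
          IsPrincipalCentreChart p M.act g₀ 𝒦 d O ∧ (x : M.V) ∈ O.1

namespace GameFrame.GModel

variable {p : ℕ} {X' X₁ : Scheme.{0}} {q : X' ⟶ X₁} {G : Type} [Group G] {ρ : G →* Aut X'} {g₀ : G}

/-- The union of the principal-centre charts of `(𝒦, d)`. -/
def principalKillOpen (M : GModel p q G ρ g₀) (𝒦 : ReesFiltration M.V) (d : ℕ) : Set M.V :=
  ⋃ (O : M.act.StableAffineOpens) (_ : IsPrincipalCentreChart p M.act g₀ 𝒦 d O), (O.1 : Set M.V)

/-- The union of the principal-centre charts is open. -/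
theorem isOpen_principalKillOpen (M : GModel p q G ρ g₀) (𝒦 : ReesFiltration M.V) (d : ℕ) : IsOpen (M.principalKillOpen 𝒦 d) :=
  isOpen_iUnion fun O => isOpen_iUnion fun _ => O.1.isOpen

/-- **THE BAD LOCUS OF A PRINCIPAL MOVE**: a bad point of `Mʼ` lies over a bad point of `M` which is in NO principal-centre chart.
[OURS · L1 W4.5c] -/
theorem mem_badLocus_of_principalMove [Finite G] (hp : p.Prime) (hG : ∀ g : G, g ∈ Subgroup.zpowers g₀) (M M' : GModel p q G ρ g₀)
    (𝒦 : ReesFiltration M.V) (d : ℕ) (hkill : IsPrincipalCentre p M.act g₀ 𝒦 d)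
    (π' : M'.V ⟶ M.V) (hbl : IsBlowup π' (𝒦.ideal d)) (hr : M'.r = π' ≫ M.r)
    (hcomm : ∀ g : G, (M'.act.aut g).hom ≫ π' = π' ≫ (M.act.aut g).hom)
    {R₀ : Type} [CommRing R₀] [IsNoetherianRing R₀] (s : M.V ⟶ Spec (.of R₀)) [LocallyOfFiniteType s]
    (hs : ∀ g : G, (M.act.aut g).hom ≫ s = s) {v' : M'.V} (hv' : v' ∈ M'.badLocus) :
    π'.base v' ∈ M.badLocus ∧ ∀ O : M.act.StableAffineOpens, IsPrincipalCentreChart p M.act g₀ 𝒦 d O → π'.base v' ∉ O.1 := by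
  have hkill' : ∀ O : M.act.StableAffineOpens, IsPrincipalCentreChart p M.act g₀ 𝒦 d O → π'.base v' ∉ O.1 := fun O hO hvO =>
    hv' (isGoodAt_of_isPrincipalCentreChart hp hG M M' 𝒦 d hkill.2.1 π' hbl hr hcomm O hO s hs v' hvO)
  refine ⟨fun hgood => ?_, hkill'⟩
  obtain ⟨O, hvO, hO | hO⟩ := hkill.2.2 (π'.base v')
  · exact hkill' O hO hvO
  · exact hv' (isGoodAt_of_isIdleChart M M' hG 𝒦 d π' hbl hr hcomm O hO hvO hgood)

/-- **`WINS` IN ONE MOVE**: if the principal-centre charts of the principal centre `(𝒦, d)` COVER the bad locus `Z(M)`, then every move of `M`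
along `(𝒦, d)` is terminal, and `M` wins. [OURS · L1 W4.5c] -/
theorem wins_of_isPrincipalCentre [Finite G] (hp : p.Prime) (hG : ∀ g : G, g ∈ Subgroup.zpowers g₀) (M : GModel p q G ρ g₀)
    (𝒦 : ReesFiltration M.V) (d : ℕ) (hkill : IsPrincipalCentre p M.act g₀ 𝒦 d)
    (hcover : ∀ v ∈ M.badLocus, ∃ O : M.act.StableAffineOpens, IsPrincipalCentreChart p M.act g₀ 𝒦 d O ∧ v ∈ O.1)
    {R₀ : Type} [CommRing R₀] [IsNoetherianRing R₀] (s : M.V ⟶ Spec (.of R₀)) [LocallyOfFiniteType s]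
    (hs : ∀ g : G, (M.act.aut g).hom ≫ s = s) : Wins p q G ρ g₀ M := by
  refine Wins.of_moves 𝒦 d (isAdmissibleCentre_of_isPrincipalCentre hkill) fun M' hmv => Wins.terminal M' ?_
  obtain ⟨π', hbl, -, hr, hcomm⟩ := hmv
  rw [terminal_iff_badLocus_eq_empty, Set.eq_empty_iff_forall_notMem]
  intro v' hv'
  obtain ⟨hbad, hno⟩ := mem_badLocus_of_principalMove hp hG M M' 𝒦 d hkill π' hbl hr hcomm s hs hv'
  obtain ⟨O, hO, hvO⟩ := hcover _ hbad
  exact hno O hO hvO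


/-- **The bad locus of a principal move embeds into `Z(M) ∖ ⋃ principal charts`.** [OURS · L1 W4.5c] -/
theorem exists_isInducing_badLocus_principalMove [Finite G] (hp : p.Prime) (hG : ∀ g : G, g ∈ Subgroup.zpowers g₀)
    (M M' : GModel p q G ρ g₀) (𝒦 : ReesFiltration M.V) (d : ℕ) (hkill : IsPrincipalCentre p M.act g₀ 𝒦 d)
    (π' : M'.V ⟶ M.V) (hbl : IsBlowup π' (𝒦.ideal d)) (hr : M'.r = π' ≫ M.r)
    (hcomm : ∀ g : G, (M'.act.aut g).hom ≫ π' = π' ≫ (M.act.aut g).hom)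
    {R₀ : Type} [CommRing R₀] [IsNoetherianRing R₀] (s : M.V ⟶ Spec (.of R₀)) [LocallyOfFiniteType s]
    (hs : ∀ g : G, (M.act.aut g).hom ≫ s = s) :
    ∃ φ : ↥M'.badLocus → ↥(M.badLocus \ M.principalKillOpen 𝒦 d), IsInducing φ := by
  -- where bad points go
  have hmem : ∀ v' : ↥M'.badLocus, π'.base v'.1 ∈ M.badLocus \ M.principalKillOpen 𝒦 d := fun v' => by
    obtain ⟨hbad, hno⟩ := mem_badLocus_of_principalMove hp hG M M' 𝒦 d hkill π' hbl hr hcomm s hs v'.2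
    refine ⟨hbad, fun h => ?_⟩
    obtain ⟨O, hO⟩ := Set.mem_iUnion.mp h
    obtain ⟨hO, hvO⟩ := Set.mem_iUnion.mp hO
    exact hno O hO hvO
  -- the idle region `W` = complement of the support, over which `π'` is an isomorphism
  let W : M.V.Opens := (𝒦.ideal d).support.compl
  haveI hiso : IsIso (π' ∣_ W) := hbl.isIso_morphismRestrict (U := W) (by
    rw [Set.disjoint_iff]; rintro x ⟨hx, hx'⟩; exact hx hx')
  have hW : ∀ v' : ↥M'.badLocus, v'.1 ∈ π' ⁻¹ᵁ W := fun v' => by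
    obtain ⟨hbad, hno⟩ := mem_badLocus_of_principalMove hp hG M M' 𝒦 d hkill π' hbl hr hcomm s hs v'.2
    obtain ⟨O, hvO, hO | hO⟩ := hkill.2.2 (π'.base v'.1)
    · exact absurd hvO (hno O hO)
    · change π'.base v'.1 ∈ ((𝒦.ideal d).support : Set M.V)ᶜ
      have hdisj := disjoint_support_of_ideal_eq_top (I := 𝒦.ideal d) hO.1.1
        (by rw [← ReesFiltration.filtration_ideal]; exact hO.2 d)
      exact Set.disjoint_left.mp hdisj hvO
  -- the embedding: `Z(M') ⊆ π'⁻¹ W ≃ W ⊆ V`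
  let e : ↥(π' ⁻¹ᵁ W) ≃ₜ ↥W := Scheme.homeoOfIso (asIso (π' ∣_ W))
  let φ₀ : ↥M'.badLocus → M.V := fun v' => ((e ⟨v'.1, hW v'⟩ : ↥W) : M.V)
  have hφ₀ : ∀ v', φ₀ v' = π'.base v'.1 := fun v' => by
    have h1 : (e ⟨v'.1, hW v'⟩ : ↥W) = (π' ∣_ W).base ⟨v'.1, hW v'⟩ := rfl
    change ((e ⟨v'.1, hW v'⟩ : ↥W) : M.V) = _
    rw [h1]
    exact morphismRestrict_base_coe π' W ⟨v'.1, hW v'⟩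
  have hind₀ : IsInducing φ₀ := by
    refine IsInducing.subtypeVal.comp (e.isInducing.comp ?_)
    exact (IsInducing.subtypeVal.codRestrict hW : IsInducing fun v' : ↥M'.badLocus => (⟨v'.1, hW v'⟩ : ↥(π' ⁻¹ᵁ W)))
  have hmem₀ : ∀ v', φ₀ v' ∈ M.badLocus \ M.principalKillOpen 𝒦 d := fun v' => by rw [hφ₀]; exact hmem v'
  exact ⟨Set.codRestrict φ₀ _ hmem₀, hind₀.codRestrict hmem₀⟩

/-- **`ν₁` DROPS UNDER A PRINCIPAL MOVE WHOSE PRINCIPAL CHARTS MEET EVERY IRREDUCIBLE COMPONENT OF `Z(M)`**: if `ν₁(M) ≤ n` then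
`ν₁(Mʼ) < n` for every move `Mʼ`. [OURS · L1 W4.5c] -/
theorem nu1_principalMove_lt [Finite G] (hp : p.Prime) (hG : ∀ g : G, g ∈ Subgroup.zpowers g₀)
    (M M' : GModel p q G ρ g₀) (𝒦 : ReesFiltration M.V) (d : ℕ) (hkill : IsPrincipalCentre p M.act g₀ 𝒦 d)
    (hhit : ∀ t ∈ irreducibleComponents ↥M.badLocus, ∃ x ∈ t, (x : M.V) ∈ M.principalKillOpen 𝒦 d)
    (π' : M'.V ⟶ M.V) (hbl : IsBlowup π' (𝒦.ideal d)) (hr : M'.r = π' ≫ M.r)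
    (hcomm : ∀ g : G, (M'.act.aut g).hom ≫ π' = π' ≫ (M.act.aut g).hom)
    {R₀ : Type} [CommRing R₀] [IsNoetherianRing R₀] (s : M.V ⟶ Spec (.of R₀)) [LocallyOfFiniteType s]
    (hs : ∀ g : G, (M.act.aut g).hom ≫ s = s) {n : ℕ} (hn : M.nu1 ≤ n) : M'.nu1 < n := by
  obtain ⟨φ, hφ⟩ := exists_isInducing_badLocus_principalMove hp hG M M' 𝒦 d hkill π' hbl hr hcomm s hs
  exact lt_of_le_of_lt hφ.topologicalKrullDim_le
    (topologicalKrullDim_diff_lt M.badLocus (M.principalKillOpen 𝒦 d) (M.isOpen_principalKillOpen 𝒦 d) hhit hn)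

/-- **THE CRUX REDUCED (principal form).** Let `G = ⟨g₀⟩` be finite, `p` prime, and `P` a property of models such that every
non-terminal `P`-model of finite type over a Noetherian base admits a PRINCIPAL centre whose principal-centre charts meet every irreducible
component of its bad locus, all of whose moves are again `P`-models over a Noetherian base. Then every `P`-model with finite `ν₁`
WINS the kill game (`GameFrame.Wins`) — by induction on `ν₁`. What `stub_winningStrategy` still needs is exactly the hypothesis `H`
((R0) centre rule of STRATEGY-DESIGN v2) for the reachable models of each datum. [OURS · L1 W4.5c] -/
theorem wins_of_principalCentres [Finite G] (hp : p.Prime) (hG : ∀ g : G, g ∈ Subgroup.zpowers g₀)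
    (P : GModel p q G ρ g₀ → Prop)
    (H : ∀ M : GModel p q G ρ g₀, P M → M.HasNoetherianBase → ¬ M.Terminal →
      ∃ (𝒦 : ReesFiltration M.V) (d : ℕ), IsPrincipalCentre p M.act g₀ 𝒦 d ∧
        (∀ t ∈ irreducibleComponents ↥M.badLocus, ∃ x ∈ t, (x : M.V) ∈ M.principalKillOpen 𝒦 d) ∧
        ∀ M' : GModel p q G ρ g₀, M.IsMoveOf M' 𝒦 d → P M' ∧ M'.HasNoetherianBase)
    (M₀ : GModel p q G ρ g₀) (hP₀ : P M₀) (hB₀ : M₀.HasNoetherianBase) {n₀ : ℕ} (hn₀ : M₀.nu1 < n₀) :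
    Wins p q G ρ g₀ M₀ := by
  suffices h : ∀ (n : ℕ) (M : GModel p q G ρ g₀), P M → M.HasNoetherianBase → M.nu1 < n → Wins p q G ρ g₀ M from
    h n₀ M₀ hP₀ hB₀ hn₀
  intro n
  induction n with
  | zero => exact fun M _ _ hn => Wins.terminal M (M.terminal_of_nu1_lt_zero hn)
  | succ n ih =>
    intro M hPM hBM hn
    by_cases hT : M.Terminal
    · exact Wins.terminal M hT
    obtain ⟨𝒦, d, hkill, hhit, hmoves⟩ := H M hPM hBM hT
    refine Wins.of_moves 𝒦 d (isAdmissibleCentre_of_isPrincipalCentre hkill) fun M' hmv => ?_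
    obtain ⟨hPM', hBM'⟩ := hmoves M' hmv
    obtain ⟨π', hbl, -, hr, hcomm⟩ := hmv
    obtain ⟨R₀, _, _, s, _, hs⟩ := hBM
    have hn' : M.nu1 ≤ n := withBot_le_of_lt_succ hn
    exact ih M' hPM' hBM' (nu1_principalMove_lt hp hG M M' 𝒦 d hkill hhit π' hbl hr hcomm s hs hn')

/-- **The principal-centre rule makes the initial model win.** [OURS · L1 W4.5c] -/
theorem wins_initial_of_principalCentreRule (hp : p.Prime) (hrule : PrincipalCentreRule p) {k : Type} [Field k] (f : X₁ ⟶ Spec (.of k))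
    [LocallyOfFiniteType f] [QuasiCompact f] [IsFinite q] [Finite G] (hG : ∀ g : G, g ∈ Subgroup.zpowers g₀)
    (hq : ∀ g : G, (ρ g).hom ≫ q = q) [IsIntegral X'] [IsLocallyNoetherian X'] (h₀ : NodeAtlas p (⟨ρ, hq⟩ : ActionOver q G) g₀) :
    Wins p q G ρ g₀ (GModel.initial hq h₀) := by
  -- the initial model has finite `ν₁`
  haveI : CompactSpace X' := by
    haveI : QuasiCompact (q ≫ f) := inferInstance
    exact (HasAffineProperty.iff_of_isAffine (P := @QuasiCompact)).mp this
  obtain ⟨n, hn⟩ := exists_topologicalKrullDim_le_of_locallyOfFiniteType (q ≫ f)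
  have hn₀ : (GModel.initial (p := p) (g₀ := g₀) hq h₀).nu1 < (n + 1 : ℕ) := by
    refine lt_of_le_of_lt ((GModel.initial hq h₀).nu1_le.trans hn) ?_
    exact_mod_cast Nat.lt_succ_self n
  refine wins_of_principalCentres hp hG (fun _ => True) (fun M _ hB hT => ?_) (GModel.initial hq h₀) trivial
    (hasNoetherianBase_of_datum f _) hn₀
  obtain ⟨𝒦, d, hkill, hhit⟩ := hrule q G ρ g₀ hG M hB hT
  refine ⟨𝒦, d, hkill, fun t ht => ?_, fun M' _ => ⟨trivial, hasNoetherianBase_of_datum f M'⟩⟩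
  obtain ⟨x, hxt, O, hO, hxO⟩ := hhit t ht
  exact ⟨x, hxt, Set.mem_iUnion.mpr ⟨O, Set.mem_iUnion.mpr ⟨hO, hxO⟩⟩⟩


/-- The depth-form kill-centre rule implies the principal-centre rule. -/
theorem _root_.Summit.ResolutionOfSingularities.ResolutionOfSingularities.Theorems.WildQuotientResolution.S1.principalCentreRule_of_killCentreRule
    (hrule : KillCentreRule p) : PrincipalCentreRule p := by
  intro X' X₁ q G _ _ ρ g₀ hG M hB hT
  obtain ⟨𝒦, d, hkill, hhit⟩ := hrule q G ρ g₀ hG M hB hT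
  refine ⟨𝒦, d, isPrincipalCentre_of_isKillCentre hkill, fun t ht => ?_⟩
  obtain ⟨x, hxt, hx⟩ := hhit t ht
  obtain ⟨O, hO⟩ := Set.mem_iUnion.mp hx
  obtain ⟨hO, hxO⟩ := Set.mem_iUnion.mp hO
  exact ⟨x, hxt, O, isPrincipalCentreChart_of_isKillCentreChart hO, hxO⟩

end GameFrame.GModel

end Summit.ResolutionOfSingularities.ResolutionOfSingularities.Theorems.WildQuotientResolution.S1

end
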